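import Summits.BirchSwinnertonDyer.BirchSwinnertonDyer.Theorems.ResidualThetaTransportAtTwoSignedMuSeedAtTwoPlusSmoothingCoboundaryPrecision
import HarnessLib

/-!
# Smoothing coboundary IX — engine transfer (CS6, algebraic form): below `t^{qʲ}` the orbit series
# `F°_β = η(β)·G_χ∘[β] − G_χ` of an element `β ≡ 1 (mod πʲ)` with `η(β) − 1` a unit has the SAME order profile as the
# class series `G_χ`; so the tilt engine's non-degeneracy input `ord S = a ∧ a + 2 < N` (`…TiltEngine`, `…TiltThreshold`)
# read on `F°_β` is a property of `G_χ` alone («`NonDeg(m; χ, 𝔩) = NonDeg(m; G_χ)` for `π_𝔩 ≡ 1 (mod 2^{k(m)})`,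
# `η(π_𝔩) ≠ 1`», line card `Cruxes/SignedMuSeedAtTwoPlus/Lines/smoothing-coboundary.md`, stub CS6 `EngineTransfer`)
# (seed crux `SignedMuSeedAtTwoPlus` stmt-BirchSwinnertonDyer-21438; parent Kμ⁺ stmt-BirchSwinnertonDyer-20689, route
# ResidualThetaTransportAtTwo)

Cell `bsd-wall`, width seat `bsd-wall-rtt-p4-w2` g15 (`--supports`, closes nothing).  THEOREMS ONLY; BSD is not proved by this.

* `order_smul_of_isUnit` — `ord (c•G) = ord G` for a unit `c`;
* `nat_le_order_iff_of_coeff_eq_mod`, **`order_eq_nat_iff_of_coeff_eq_mod`**, `nonDeg_iff_of_coeff_eq_mod` — series congruent modulo `tᴺ` have the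
  same order profile below `N`;
* `coeff_twistSubst_of_modEq_X` — `s ≡ t (mod tᴺ) ⟹ η·G∘s − G ≡ (η − 1)·G (mod tᴺ)`;
* **`order_twistSubst_eq_iff`**, **`nonDeg_twistSubst_iff`** — for `s ≡ t (mod tᴺ)` and `η − 1` a unit:
  `ord (η·G∘s − G) = a ⟺ ord G = a` for every `a < N`, hence `(∃ a, ord (η·G∘s − G) = a ∧ a + 2 < N) ⟺ (∃ a, ord G = a ∧ a + 2 < N)`
  — the engine's `NonDeg` hypothesis shape (`…TiltEngine.oddDigit_of_nonDeg`: `ord S_{m₀} = a₀`, `a₀ + 2 < 4^{m₀+1}`);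
* the Lubin–Tate form (`s = [1 + πʲw]‾`, `N ≤ qʲ`) is the companion file `…SmoothingCoboundaryEngineTransferLT`.

Not here: the identification of the engine's `S_m = D log Z'_{ρ,m}` with the orbit series `F°` (ports S1/CS1, geometric).
[folklore]
-/

noncomputable section

set_option autoImplicit false
-- the Theorems namespace of this sub repeats the summit name by design (D-0017 nested layout)
set_option linter.dupNamespace false

open PowerSeries

namespace Summit.BirchSwinnertonDyer.BirchSwinnertonDyer.Theorems.SignedMuAtTwo.SmoothingCoboundary

section Order

variable {k : Type*} [CommRing k]

/-- Scaling by a unit does not change the order. [folklore] -/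
theorem order_smul_of_isUnit {c : k} (hc : IsUnit c) (G : PowerSeries k) : (c • G).order = G.order := by
  refine le_antisymm ?_ ?_
  · refine le_order _ _ fun i hi => ?_
    have h := coeff_of_lt_order i hi
    rw [map_smul, smul_eq_mul] at h
    exact (hc.mul_right_eq_zero).mp h
  · refine le_order _ _ fun i hi => ?_
    rw [map_smul, smul_eq_mul, coeff_of_lt_order i hi, mul_zero]

/-- Series congruent modulo `tᴺ` have the same order profile up to `N`: `↑a ≤ ord S ⟺ ↑a ≤ ord S'` for `a ≤ N`.
[folklore] -/
theorem nat_le_order_iff_of_coeff_eq_mod {S S' : PowerSeries k} {N : ℕ} (h : ∀ i < N, coeff i S = coeff i S')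
    {a : ℕ} (ha : a ≤ N) : (a : ℕ∞) ≤ S.order ↔ (a : ℕ∞) ≤ S'.order := by
  constructor
  · intro hle
    refine nat_le_order _ _ fun i hi => ?_
    rw [← h i (by omega)]
    exact coeff_of_lt_order i (lt_of_lt_of_le (by exact_mod_cast hi) hle)
  · intro hle
    refine nat_le_order _ _ fun i hi => ?_
    rw [h i (by omega)]
    exact coeff_of_lt_order i (lt_of_lt_of_le (by exact_mod_cast hi) hle)

/-- **Series congruent modulo `tᴺ` have the same order profile below `N`**: `ord S = a ⟺ ord S' = a` for `a < N`.
[folklore] -/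
theorem order_eq_nat_iff_of_coeff_eq_mod {S S' : PowerSeries k} {N : ℕ} (h : ∀ i < N, coeff i S = coeff i S')
    {a : ℕ} (ha : a < N) : S.order = a ↔ S'.order = a := by
  rw [order_eq_nat, order_eq_nat, h a ha]
  refine and_congr Iff.rfl ⟨fun h' i hi => ?_, fun h' i hi => ?_⟩
  · rw [← h i (by omega)]; exact h' i hi
  · rw [h i (by omega)]; exact h' i hi

/-- The engine's non-degeneracy shape is congruence-invariant: `(∃ a, ord S = a ∧ a + 2 < N)` depends only on `S mod tᴺ`.
[folklore] -/
theorem nonDeg_iff_of_coeff_eq_mod {S S' : PowerSeries k} {N : ℕ} (h : ∀ i < N, coeff i S = coeff i S') :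
    (∃ a : ℕ, S.order = a ∧ a + 2 < N) ↔ (∃ a : ℕ, S'.order = a ∧ a + 2 < N) := by
  constructor
  · rintro ⟨a, hS, ha⟩
    exact ⟨a, (order_eq_nat_iff_of_coeff_eq_mod h (by omega)).mp hS, ha⟩
  · rintro ⟨a, hS, ha⟩
    exact ⟨a, (order_eq_nat_iff_of_coeff_eq_mod h (by omega)).mpr hS, ha⟩

end Order

section Twist

variable {k : Type*} [CommRing k]

/-- **`s ≡ t (mod tᴺ) ⟹ η·G∘s − G ≡ (η − 1)·G (mod tᴺ)`** (`…Precision.twistSubst_congr_mod` with `s' = t`, `G∘t = G`).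
[folklore] -/
theorem coeff_twistSubst_of_modEq_X (η : k) {s G : PowerSeries k} (hs0 : constantCoeff s = 0) {N : ℕ}
    (hs : ∀ i < N, coeff i s = coeff i (X : PowerSeries k)) :
    ∀ n < N, coeff n (η • G.subst s - G) = coeff n ((η - 1) • G) := by
  intro n hn
  have h := twistSubst_congr_mod η hs0 constantCoeff_X hs (G := G) (G' := G) (fun _ _ => rfl) n hn
  rw [h, X_subst, sub_smul, one_smul]

/-- **Order transfer**: for `s ≡ t (mod tᴺ)` and `η − 1` a unit, `ord (η·G∘s − G) = a ⟺ ord G = a` for every `a < N`.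
[folklore] -/
theorem order_twistSubst_eq_iff {η : k} (hη : IsUnit (η - 1)) {s G : PowerSeries k} (hs0 : constantCoeff s = 0)
    {N : ℕ} (hs : ∀ i < N, coeff i s = coeff i (X : PowerSeries k)) {a : ℕ} (ha : a < N) :
    PowerSeries.order (η • G.subst s - G) = a ↔ G.order = a := by
  have h := coeff_twistSubst_of_modEq_X η (G := G) hs0 hs
  rw [order_eq_nat_iff_of_coeff_eq_mod h ha, order_smul_of_isUnit hη]

/-- **`NonDeg` transfer** (CS6, algebraic form): for `s ≡ t (mod tᴺ)` and `η − 1` a unit, the engine's non-degeneracy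
`∃ a, ord (η·G∘s − G) = a ∧ a + 2 < N` holds iff `∃ a, ord G = a ∧ a + 2 < N`. [folklore] -/
theorem nonDeg_twistSubst_iff {η : k} (hη : IsUnit (η - 1)) {s G : PowerSeries k} (hs0 : constantCoeff s = 0)
    {N : ℕ} (hs : ∀ i < N, coeff i s = coeff i (X : PowerSeries k)) :
    (∃ a : ℕ, PowerSeries.order (η • G.subst s - G) = a ∧ a + 2 < N) ↔ (∃ a : ℕ, G.order = a ∧ a + 2 < N) := by
  have h := coeff_twistSubst_of_modEq_X η (G := G) hs0 hs
  rw [nonDeg_iff_of_coeff_eq_mod h]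
  constructor
  · rintro ⟨a, hS, ha⟩; exact ⟨a, by rwa [order_smul_of_isUnit hη] at hS, ha⟩
  · rintro ⟨a, hS, ha⟩; exact ⟨a, by rwa [order_smul_of_isUnit hη], ha⟩

end Twist

end Summit.BirchSwinnertonDyer.BirchSwinnertonDyer.Theorems.SignedMuAtTwo.SmoothingCoboundary
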